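import Summits.BirchSwinnertonDyer.Rank1Residual.GaloisImage.SmallImageInertiaOrderCyclotomic
import HarnessLib

/-!
# The NIVEAU DICHOTOMY at EVERY prime `p`: on a tame inertia image (`p ∤ e_p`) either
# `e_p = p − 1` with a STABLE PAIR (niveau 1, `E[p]|_I ≅ χ₁ ⊕ χ₂`) or `e_p ∤ p − 1` with NO stable
# line (niveau 2) — GEN 8's `p = 3` dichotomy (`e₃ ∈ {2, 8}`) at general `p`; O8-TAME part 9
# (cell `b2b-bsdres`, lane CLASS-CLOSURE, seat cc-typer-1 = typer of record N11 / O8, GEN 9; joint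
# small-image axis O8 / N2 / N3; sub-partition key `e_p` / niveau of O8/SUBPARTITION-typed v1.9)

HONEST FRAMING (cell `b2b-bsdres`, run/shared/lean/b2b/bsd-rank1-residual/, verbatim in every
file): the goal of the cell is to DELETE the COMBINATION-SHAPED residual classes of the
Birch–Swinnerton-Dyer formula for ALL analytic-rank `≤ 1` elliptic curves over `ℚ` — "full BSD
formula for every rank `≤ 1` curve in class `C`" assembled STRICTLY from published theorems — so
that the rank-`≤ 1` remainder becomes exactly the CONSTRUCTION-SHAPED classes, which are TYPED
(missing-input `Prop`s), NOT attempted. This is not "finishing BSD". Lane CLASS-CLOSURE: research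
routes, no claim beyond the stated classes; census output = EVIDENCE, never a Literature fact;
NOTHING is booked here. THEOREMS ONLY: no definition, no named fact, no conjecture, no `sorry`.

## What and why

At `p = 3` GEN 8 proved `3 ∤ e₃ ⟹ (e₃ = 2 ∧ InertiaSplitAt) ∨ (e₃ = 8 ∧ no stable line)` by a
`decide` over `GL₂(𝔽₃)`. The general-`p` statement needs one piece of linear algebra: **an element
`s` acting on `E[p]` with `s^{p−1} = 1` has an EIGENVECTOR** (its minimal polynomial divides
`X^{p−1} − 1 = ∏_{a ∈ 𝔽_pˣ} (X − a)`). It is proved here FRAME-FREE by the projector identity: for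
`Q ∈ E[p]` and `a ∈ 𝔽_pˣ` put `R_a(Q) = Σ_{j < p−1} a^j · s^j Q`; then `a · s R_a(Q) = R_a(Q)`
(telescoping, `a^{p−1} = 1`, `s^{p−1} = 1`) and `Σ_a R_a(Q) = (p − 1)·Q + Σ_{0<j<p−1} (Σ_a a^j)·s^j Q
= −Q` (power sums over `𝔽_pˣ`, `FiniteField.sum_pow_units`), so some `R_a(Q) ≠ 0` is an
eigenvector. With GEN 7/8's parts (tame generator `s` of `ρ̄(I_𝔓)`, `e_p = ord ρ̄(s)`; a stable line
has a stable complement when `p ∤ e_p`; a stable pair forces `e_p ∣ p − 1`) and part 8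
(`(p − 1) ∣ e_p`), this gives:

* §1 `exists_eigenvector_of_pow_sub_one_smul_eq_self` — the projector lemma on `E[p]`.
* §2 `exists_stableLine_of_card_inertia_map_dvd_sub_one` — `p ∤ e_p`, `e_p ∣ p − 1` ⟹ an
  `I_𝔓`-stable line; `exists_stablePair_of_card_inertia_map_dvd_sub_one` — hence a stable pair.
* §3 **`card_inertia_map_eq_sub_one_or_not_dvd_sub_one`** — THE DICHOTOMY: `p ∤ e_p ⟹
  (e_p = p − 1 ∧ stable pair) ∨ ((p − 1) ∣ e_p ∧ e_p ∤ p − 1 ∧ no I_𝔓-stable line)`;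
  `exists_stablePair_iff_card_inertia_map_eq_sub_one` (`p ∤ e_p`: stable pair ⟺ `e_p = p − 1`);
  O8 forms `O8.card_inertia_map_eq_sub_one_or_no_stableLine`,
  `O8.stablePair_iff_card_inertia_map_eq_sub_one` (every O8 row, every `p`, every `𝔓 ∣ p`).

Sub-partition reading: NIVEAU 1 ⟺ `e_p = p − 1` ⟺ stable pair, NIVEAU 2 ⟺ `e_p ∤ p − 1` ⟺ no
stable line — theorems at every `p` on every tame row (O8: all rows). Nothing about BSD_p; no mark.

References: [Serre1972] §1.3 (tame characters of niveau 1/2), §1.11; [SerreLocalFields1979] Ch. IV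
§2 Cor. 1–3; [Edixhoven1997Serre] §4.2; Washington GTM 83 Lemma 1.4 (power sums over `𝔽_pˣ`);
class-closure/O8/STATEMENT.md §§13–20.
-/

set_option autoImplicit false

noncomputable section

open scoped Classical NumberField

open Field IsDedekindDomain NumberField WeierstrassCurve
  Literature.NumberTheory.EllipticCurves Literature.NumberTheory.GaloisRepresentations
  Literature.NumberTheory.EllipticCurves.Rank1Residual
  Summit.BirchSwinnertonDyer.Rank1Residual.Additive.MixedCongruence

namespace Summit.BirchSwinnertonDyer.Rank1Residual.GaloisImage

/-! ## §1. The projector lemma: `s^{p−1} = 1` on `E[p]` ⟹ `s` has an eigenvector -/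

section Eigen

variable {W : WeierstrassCurve ℚ} [W.IsElliptic] {p : ℕ} [hp : Fact p.Prime]

omit [W.IsElliptic] in
/-- Integer scalars on `E[p]` only depend on their residue mod `p`. [folklore] -/
theorem zsmul_eq_zsmul_of_intCast_eq_torsion {m m' : ℤ} (h : (m : ZMod p) = m')
    (P : geomTorsion W (p : ℤ)) : m • P = m' • P := by
  obtain ⟨c, hc⟩ := (ZMod.intCast_eq_intCast_iff_dvd_sub m' m p).mp h.symm
  have hm : m = m' + p * c := by linear_combination hc
  rw [hm, add_zsmul, mul_comm, mul_zsmul, natCast_zsmul_eq_zero, zsmul_zero, add_zero]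

omit [W.IsElliptic] in
/-- **The projector lemma.** If `s ∈ Γ_ℚ` acts on `E[p]` with `s^{p−1} = 1`, then for every `Q ≠ 0`
some `R_a(Q) = Σ_{j<p−1} a^j s^j Q` (`a ∈ 𝔽_pˣ`) is a NON-ZERO EIGENVECTOR of `s`:
`a · s R_a(Q) = R_a(Q)` and `Σ_a R_a(Q) = −Q`. [cite: Washington1997, Ch. 1 Lemma 1.4 (power sums)]
[cite: Serre1972, §1.3] -/
theorem exists_eigenvector_of_pow_sub_one_smul_eq_self (s : absoluteGaloisGroup ℚ)
    (hs : ∀ P : geomTorsion W (p : ℤ), s ^ (p - 1) • P = P) {Q : geomTorsion W (p : ℤ)}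
    (hQ : Q ≠ 0) :
    ∃ (c : ℤ) (P₀ : geomTorsion W (p : ℤ)), P₀ ≠ 0 ∧ s • P₀ = c • P₀ := by
  have hpP : p.Prime := hp.out
  haveI : NeZero p := ⟨hpP.ne_zero⟩
  have h2p : 2 ≤ p := hpP.two_le
  -- the family `f a j = a^j • s^j • Q` and the projectors `R a`
  set f : (ZMod p)ˣ → ℕ → geomTorsion W (p : ℤ) :=
    fun a j ↦ ((((a : ZMod p).val ^ j : ℕ)) : ℤ) • (s ^ j • Q) with hf
  set R : (ZMod p)ˣ → geomTorsion W (p : ℤ) := fun a ↦ ∑ j ∈ Finset.range (p - 1), f a j with hR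
  -- (1) `a • (s • R a) = R a`
  have heig : ∀ a : (ZMod p)ˣ, (((a : ZMod p).val : ℕ) : ℤ) • (s • R a) = R a := by
    intro a
    have hlast : f a (p - 1) = f a 0 := by
      have h1 : ((((((a : ZMod p).val ^ (p - 1) : ℕ)) : ℤ)) : ZMod p) = ((((1 : ℕ) : ℤ)) : ZMod p) := by
        push_cast
        rw [ZMod.natCast_zmod_val]
        exact ZMod.pow_card_sub_one_eq_one (Units.ne_zero a)
      simp only [hf, pow_zero, Nat.cast_one, one_smul]
      rw [hs Q, zsmul_eq_zsmul_of_intCast_eq_torsion h1, Nat.cast_one, one_smul]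
    have hshift : ∀ j : ℕ, (((a : ZMod p).val : ℕ) : ℤ) • (s • f a j) = f a (j + 1) := by
      intro j
      simp only [hf]
      rw [smul_comm s _ (s ^ j • Q), smul_smul, ← mul_smul s, ← pow_succ']
      congr 1
      push_cast
      ring
    calc (((a : ZMod p).val : ℕ) : ℤ) • (s • R a)
        = ∑ j ∈ Finset.range (p - 1), f a (j + 1) := by
          simp only [hR, Finset.smul_sum, hshift]
      _ = ∑ j ∈ Finset.range (p - 2), f a (j + 1) + f a (p - 2 + 1) := by
          rw [show p - 1 = (p - 2) + 1 by omega, Finset.sum_range_succ]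
      _ = ∑ j ∈ Finset.range (p - 2), f a (j + 1) + f a 0 := by
          rw [show p - 2 + 1 = p - 1 by omega, hlast]
      _ = R a := by
          simp only [hR]
          rw [show p - 1 = (p - 2) + 1 by omega, Finset.sum_range_succ']
  -- (2) `Σ_a R a = -Q`
  have hsum : ∑ a : (ZMod p)ˣ, R a = -Q := by
    have hswap : ∑ a : (ZMod p)ˣ, R a =
        ∑ j ∈ Finset.range (p - 1),
          (∑ a : (ZMod p)ˣ, ((((a : ZMod p).val ^ j : ℕ)) : ℤ)) • (s ^ j • Q) := by
      simp only [hR, hf]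
      rw [Finset.sum_comm]
      refine Finset.sum_congr rfl fun j _ ↦ ?_
      rw [Finset.sum_smul]
    -- the `j = 0` term is `(p - 1) • Q = -Q`; the others vanish (power sums over `𝔽_pˣ`)
    have h0 : (∑ a : (ZMod p)ˣ, ((((a : ZMod p).val ^ 0 : ℕ)) : ℤ)) • (s ^ 0 • Q) = -Q := by
      have h1 : ((((p - 1 : ℕ) : ℤ)) : ZMod p) = ((-1 : ℤ) : ZMod p) := by
        rw [Int.cast_natCast, Nat.cast_sub hpP.one_le, ZMod.natCast_self, zero_sub, Nat.cast_one,
          Int.cast_neg, Int.cast_one]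
      simp only [pow_zero, Nat.cast_one, Finset.sum_const, Finset.card_univ, nsmul_eq_mul, mul_one,
        one_smul, ZMod.card_units p]
      rw [zsmul_eq_zsmul_of_intCast_eq_torsion h1, neg_one_zsmul]
    have hj : ∀ j ∈ Finset.range (p - 2),
        (∑ a : (ZMod p)ˣ, ((((a : ZMod p).val ^ (j + 1) : ℕ)) : ℤ)) • (s ^ (j + 1) • Q) = 0 := by
      intro j hj
      rw [Finset.mem_range] at hj
      have hz : (((∑ a : (ZMod p)ˣ, ((((a : ZMod p).val ^ (j + 1) : ℕ)) : ℤ)) : ℤ) : ZMod p) =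
          ((0 : ℤ) : ZMod p) := by
        push_cast
        simp only [ZMod.natCast_zmod_val]
        rw [FiniteField.sum_pow_units (ZMod p) (j + 1), ZMod.card p, if_neg]
        intro hdvd
        have := Nat.le_of_dvd (Nat.succ_pos j) hdvd
        omega
      rw [zsmul_eq_zsmul_of_intCast_eq_torsion hz, zero_smul]
    rw [hswap, show p - 1 = (p - 2) + 1 by omega, Finset.sum_range_succ', Finset.sum_eq_zero hj,
      zero_add, h0]
  -- (3) some `R a ≠ 0`
  obtain ⟨a, ha⟩ : ∃ a : (ZMod p)ˣ, R a ≠ 0 := by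
    by_contra h
    push Not at h
    have : ∑ a : (ZMod p)ˣ, R a = 0 := Finset.sum_eq_zero fun a _ ↦ h a
    rw [hsum, neg_eq_zero] at this
    exact hQ this
  -- the eigenvalue is `a⁻¹`
  refine ⟨(((a⁻¹ : (ZMod p)ˣ) : ZMod p).val : ℤ), R a, ha, ?_⟩
  have hinv : (((((a⁻¹ : (ZMod p)ˣ) : ZMod p).val : ℤ) * (((a : ZMod p).val : ℕ) : ℤ) : ℤ) : ZMod p) =
      ((1 : ℤ) : ZMod p) := by
    push_cast
    rw [ZMod.natCast_zmod_val, ZMod.natCast_zmod_val]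
    exact inv_mul_cancel₀ (Units.ne_zero a)
  calc s • R a = (1 : ℤ) • (s • R a) := (one_zsmul _).symm
    _ = ((((a⁻¹ : (ZMod p)ˣ) : ZMod p).val : ℤ) * (((a : ZMod p).val : ℕ) : ℤ)) • (s • R a) :=
        (zsmul_eq_zsmul_of_intCast_eq_torsion hinv _).symm
    _ = (((a⁻¹ : (ZMod p)ˣ) : ZMod p).val : ℤ) • R a := by rw [mul_zsmul, heig]

end Eigen

/-! ## §2. `p ∤ e_p`, `e_p ∣ p − 1` ⟹ an `I_𝔓`-stable line, hence a stable pair -/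

section StableLine

variable {W : WeierstrassCurve ℚ} [W.IsElliptic] {p : ℕ} [hp : Fact p.Prime]

/-- **`p ∤ e_p` and `e_p ∣ p − 1` ⟹ an `I_𝔓`-STABLE LINE.** The tame generator `s` of `ρ̄(I_𝔓)`
(GEN 8 `exists_card_inertia_map_eq_orderOf_of_not_dvd_card`) has `s^{p−1} = 1`, hence an eigenvector
`P₀` (§1); the line `ℤ P₀` is stable under every `σ ∈ I_𝔓` (`ρ̄ σ = ρ̄(s)^k`).
[cite: Serre1972, §1.3] [cite: SerreLocalFields1979, Ch. IV §2 Cor. 1–3] -/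
theorem exists_stableLine_of_card_inertia_map_dvd_sub_one
    {v : HeightOneSpectrum (𝓞 ℚ)} (hv : ((p : ℕ) : 𝓞 ℚ) ∈ v.asIdeal)
    {𝔓 : Ideal (absIntegers (𝓞 ℚ) ℚ)} (h𝔓 : 𝔓 ∈ v.primesAbove)
    (hI : ¬ p ∣ Nat.card ((𝔓.inertia (absoluteGaloisGroup ℚ)).map (galoisRepTorsion W p)))
    (hdvd : Nat.card ((𝔓.inertia (absoluteGaloisGroup ℚ)).map (galoisRepTorsion W p)) ∣ p - 1) :
    ∃ L : AddSubgroup (geomTorsion W (p : ℤ)), Nat.card L = p ∧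
      ∀ σ ∈ 𝔓.inertia (absoluteGaloisGroup ℚ), ∀ P ∈ L, σ • P ∈ L := by
  have hpP : p.Prime := hp.out
  obtain ⟨s, -, hgen, hcard⟩ := exists_card_inertia_map_eq_orderOf_of_not_dvd_card hv h𝔓 hI
  -- `ρ̄(s)^{p-1} = 1`, i.e. `s^{p-1}` acts trivially
  have hpow : galoisRepTorsion W p s ^ (p - 1) = 1 :=
    orderOf_dvd_iff_pow_eq_one.mp (hcard ▸ hdvd)
  have hs : ∀ P : geomTorsion W (p : ℤ), s ^ (p - 1) • P = P := by
    rw [← galoisRepTorsion_eq_one_iff', map_pow]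
    exact hpow
  -- a non-zero point of `E[p]` (`#E[p] = p² > 1`)
  obtain ⟨Q, hQ⟩ : ∃ Q : geomTorsion W (p : ℤ), Q ≠ 0 := by
    have hE := Literature.NumberTheory.EllipticCurves.natCard_geomTorsion W p
    haveI : Finite (geomTorsion W (p : ℤ)) :=
      Nat.finite_of_card_ne_zero (by rw [hE]; exact pow_ne_zero 2 hpP.ne_zero)
    have h1 : 1 < Nat.card (geomTorsion W (p : ℤ)) := by
      rw [hE]; exact Nat.one_lt_pow two_ne_zero hpP.one_lt
    obtain ⟨x, y, hxy⟩ := (Finite.one_lt_card_iff_nontrivial.mp h1)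
    by_cases hx : x = 0
    · exact ⟨y, fun hy ↦ hxy (hx.trans hy.symm)⟩
    · exact ⟨x, hx⟩
  obtain ⟨c, P₀, hP₀, hsP₀⟩ := exists_eigenvector_of_pow_sub_one_smul_eq_self s hs hQ
  -- the line `ℤ P₀`
  have hord : addOrderOf P₀ = p :=
    addOrderOf_eq_prime (by rw [← natCast_zsmul]; exact natCast_zsmul_eq_zero P₀) hP₀
  refine ⟨AddSubgroup.zmultiples P₀, by rw [Nat.card_zmultiples, hord], ?_⟩
  -- `s` acts on the line by the scalar `c`
  have hcL : ∀ P ∈ AddSubgroup.zmultiples P₀, s • P = c • P := by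
    intro P hP
    obtain ⟨n, rfl⟩ := AddSubgroup.mem_zmultiples_iff.mp hP
    rw [smul_comm s n P₀, hsP₀, smul_comm n c P₀]
  intro σ hσ P hP
  obtain ⟨k, hk⟩ := hgen σ hσ
  -- reduce the exponent mod `p - 1` to a natural number
  have hk' : galoisRepTorsion W p σ = galoisRepTorsion W p s ^ ((k % ((p - 1 : ℕ) : ℤ)).toNat) := by
    rw [hk, zpow_eq_zpow_emod' k hpow, ← zpow_natCast,
      Int.toNat_of_nonneg (Int.emod_nonneg _ (by exact_mod_cast (Nat.sub_ne_zero_of_lt hpP.one_lt)))]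
  have hσP : σ • P = s ^ ((k % ((p - 1 : ℕ) : ℤ)).toNat) • P := by
    rw [← galoisRepTorsion_apply, hk', ← map_pow, galoisRepTorsion_apply]
  rw [hσP, pow_smul_eq_pow_zsmul_of_forall_mem hcL _ hP]
  exact AddSubgroup.zsmul_mem _ hP _

/-- **`p ∤ e_p` and `e_p ∣ p − 1` ⟹ a STABLE PAIR** (§2 + GEN 7's stable complement
`exists_stable_complement_of_stableLine_of_not_dvd_card`). [cite: Serre1972, §1.3]
[cite: Edixhoven1997Serre, §4.2 (PDF p. 297)] -/
theorem exists_stablePair_of_card_inertia_map_dvd_sub_one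
    {v : HeightOneSpectrum (𝓞 ℚ)} (hv : ((p : ℕ) : 𝓞 ℚ) ∈ v.asIdeal)
    {𝔓 : Ideal (absIntegers (𝓞 ℚ) ℚ)} (h𝔓 : 𝔓 ∈ v.primesAbove)
    (hI : ¬ p ∣ Nat.card ((𝔓.inertia (absoluteGaloisGroup ℚ)).map (galoisRepTorsion W p)))
    (hdvd : Nat.card ((𝔓.inertia (absoluteGaloisGroup ℚ)).map (galoisRepTorsion W p)) ∣ p - 1) :
    ∃ X Y : AddSubgroup (geomTorsion W (p : ℤ)), Nat.card X = p ∧ Nat.card Y = p ∧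
      X ⊓ Y = ⊥ ∧ X ⊔ Y = ⊤ ∧
      (∀ σ ∈ 𝔓.inertia (absoluteGaloisGroup ℚ), ∀ P ∈ X, σ • P ∈ X) ∧
      (∀ σ ∈ 𝔓.inertia (absoluteGaloisGroup ℚ), ∀ P ∈ Y, σ • P ∈ Y) :=
  (exists_stablePair_iff_not_dvd_card_of_stableLine
    (exists_stableLine_of_card_inertia_map_dvd_sub_one hv h𝔓 hI hdvd)).mpr hI

end StableLine

/-! ## §3. The dichotomy at every `p` -/

section Dichotomy

variable {W : WeierstrassCurve ℚ} [W.IsElliptic] {p : ℕ} [hp : Fact p.Prime]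

/-- **THE NIVEAU DICHOTOMY, every `p`.** If `p ∤ e_p = #ρ̄_{E,p}(I_𝔓)` then EITHER `e_p = p − 1`
and `E[p]` has an `I_𝔓`-stable pair of complementary lines (niveau 1: `E[p]|_{I_𝔓} ≅ χ₁ ⊕ χ₂`), OR
`(p − 1) ∣ e_p`, `e_p ∤ p − 1` and `E[p]` has NO `I_𝔓`-stable line (niveau 2). GEN 8's `p = 3`
statement (`e₃ = 2` or `e₃ = 8`) is the case `p = 3`. [cite: Serre1972, §1.3 and §1.11]
[cite: SerreLocalFields1979, Ch. IV §2 Cor. 1–3] [cite: Edixhoven1997Serre, §4.2 (PDF p. 297)] -/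
theorem card_inertia_map_eq_sub_one_or_not_dvd_sub_one
    {v : HeightOneSpectrum (𝓞 ℚ)} (hv : ((p : ℕ) : 𝓞 ℚ) ∈ v.asIdeal)
    {𝔓 : Ideal (absIntegers (𝓞 ℚ) ℚ)} (h𝔓 : 𝔓 ∈ v.primesAbove)
    (hI : ¬ p ∣ Nat.card ((𝔓.inertia (absoluteGaloisGroup ℚ)).map (galoisRepTorsion W p))) :
    (Nat.card ((𝔓.inertia (absoluteGaloisGroup ℚ)).map (galoisRepTorsion W p)) = p - 1 ∧
        ∃ X Y : AddSubgroup (geomTorsion W (p : ℤ)), Nat.card X = p ∧ Nat.card Y = p ∧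
          X ⊓ Y = ⊥ ∧ X ⊔ Y = ⊤ ∧
          (∀ σ ∈ 𝔓.inertia (absoluteGaloisGroup ℚ), ∀ P ∈ X, σ • P ∈ X) ∧
          (∀ σ ∈ 𝔓.inertia (absoluteGaloisGroup ℚ), ∀ P ∈ Y, σ • P ∈ Y)) ∨
      ((p - 1) ∣ Nat.card ((𝔓.inertia (absoluteGaloisGroup ℚ)).map (galoisRepTorsion W p)) ∧
        ¬ Nat.card ((𝔓.inertia (absoluteGaloisGroup ℚ)).map (galoisRepTorsion W p)) ∣ p - 1 ∧
        ¬ ∃ L : AddSubgroup (geomTorsion W (p : ℤ)), Nat.card L = p ∧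
          ∀ σ ∈ 𝔓.inertia (absoluteGaloisGroup ℚ), ∀ P ∈ L, σ • P ∈ L) := by
  by_cases hdvd : Nat.card ((𝔓.inertia (absoluteGaloisGroup ℚ)).map (galoisRepTorsion W p)) ∣ p - 1
  · have hpair := exists_stablePair_of_card_inertia_map_dvd_sub_one hv h𝔓 hI hdvd
    exact Or.inl ⟨card_inertia_map_eq_sub_one_of_stablePair hv h𝔓 hpair, hpair⟩
  · refine Or.inr ⟨sub_one_dvd_card_inertia_map_galoisRepTorsion W p hv h𝔓, hdvd, fun hL ↦ hdvd ?_⟩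
    exact card_inertia_map_dvd_sub_one_of_stablePair hv h𝔓
      ((exists_stablePair_iff_not_dvd_card_of_stableLine hL).mpr hI)

/-- **On a tame row, STABLE PAIR ⟺ `e_p = p − 1`** (niveau 1 read on the order of the inertia
image). [cite: Serre1972, §1.3 and §1.11] [cite: Edixhoven1997Serre, §4.2 (PDF p. 297)] -/
theorem exists_stablePair_iff_card_inertia_map_eq_sub_one
    {v : HeightOneSpectrum (𝓞 ℚ)} (hv : ((p : ℕ) : 𝓞 ℚ) ∈ v.asIdeal)
    {𝔓 : Ideal (absIntegers (𝓞 ℚ) ℚ)} (h𝔓 : 𝔓 ∈ v.primesAbove)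
    (hI : ¬ p ∣ Nat.card ((𝔓.inertia (absoluteGaloisGroup ℚ)).map (galoisRepTorsion W p))) :
    (∃ X Y : AddSubgroup (geomTorsion W (p : ℤ)), Nat.card X = p ∧ Nat.card Y = p ∧
        X ⊓ Y = ⊥ ∧ X ⊔ Y = ⊤ ∧
        (∀ σ ∈ 𝔓.inertia (absoluteGaloisGroup ℚ), ∀ P ∈ X, σ • P ∈ X) ∧
        (∀ σ ∈ 𝔓.inertia (absoluteGaloisGroup ℚ), ∀ P ∈ Y, σ • P ∈ Y)) ↔
      Nat.card ((𝔓.inertia (absoluteGaloisGroup ℚ)).map (galoisRepTorsion W p)) = p - 1 := by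
  refine ⟨card_inertia_map_eq_sub_one_of_stablePair hv h𝔓, fun h ↦ ?_⟩
  exact exists_stablePair_of_card_inertia_map_dvd_sub_one hv h𝔓 hI (h ▸ dvd_rfl)

/-- **No stable line ⟺ `e_p ∤ p − 1`** on a tame row (niveau 2 read on the order of the inertia
image). [cite: Serre1972, §1.3 and §1.11] -/
theorem not_exists_stableLine_iff_not_card_inertia_map_dvd_sub_one
    {v : HeightOneSpectrum (𝓞 ℚ)} (hv : ((p : ℕ) : 𝓞 ℚ) ∈ v.asIdeal)
    {𝔓 : Ideal (absIntegers (𝓞 ℚ) ℚ)} (h𝔓 : 𝔓 ∈ v.primesAbove)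
    (hI : ¬ p ∣ Nat.card ((𝔓.inertia (absoluteGaloisGroup ℚ)).map (galoisRepTorsion W p))) :
    (¬ ∃ L : AddSubgroup (geomTorsion W (p : ℤ)), Nat.card L = p ∧
        ∀ σ ∈ 𝔓.inertia (absoluteGaloisGroup ℚ), ∀ P ∈ L, σ • P ∈ L) ↔
      ¬ Nat.card ((𝔓.inertia (absoluteGaloisGroup ℚ)).map (galoisRepTorsion W p)) ∣ p - 1 := by
  constructor
  · intro hno hdvd
    exact hno (exists_stableLine_of_card_inertia_map_dvd_sub_one hv h𝔓 hI hdvd)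
  · intro hdvd hL
    exact hdvd (card_inertia_map_dvd_sub_one_of_stablePair hv h𝔓
      ((exists_stablePair_iff_not_dvd_card_of_stableLine hL).mpr hI))

/-- **O8 (every `p`, every O8 row, every `𝔓 ∣ p`): the niveau dichotomy** — `Irr W p ∧ ¬ Surj W p`
forces `p ∤ e_p` (GEN 7), so `e_p = p − 1` with a stable pair, or `e_p ∤ p − 1` with no stable line.
[cite: Serre1972, §1.3, §1.11 and §2.4 Prop. 15] -/
theorem O8.card_inertia_map_eq_sub_one_or_no_stableLine (hX : ClassX4 W p) (hns : ¬ Surj W p)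
    {v : HeightOneSpectrum (𝓞 ℚ)} (hv : ((p : ℕ) : 𝓞 ℚ) ∈ v.asIdeal)
    {𝔓 : Ideal (absIntegers (𝓞 ℚ) ℚ)} (h𝔓 : 𝔓 ∈ v.primesAbove) :
    (Nat.card ((𝔓.inertia (absoluteGaloisGroup ℚ)).map (galoisRepTorsion W p)) = p - 1 ∧
        ∃ X Y : AddSubgroup (geomTorsion W (p : ℤ)), Nat.card X = p ∧ Nat.card Y = p ∧
          X ⊓ Y = ⊥ ∧ X ⊔ Y = ⊤ ∧
          (∀ σ ∈ 𝔓.inertia (absoluteGaloisGroup ℚ), ∀ P ∈ X, σ • P ∈ X) ∧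
          (∀ σ ∈ 𝔓.inertia (absoluteGaloisGroup ℚ), ∀ P ∈ Y, σ • P ∈ Y)) ∨
      ((p - 1) ∣ Nat.card ((𝔓.inertia (absoluteGaloisGroup ℚ)).map (galoisRepTorsion W p)) ∧
        ¬ Nat.card ((𝔓.inertia (absoluteGaloisGroup ℚ)).map (galoisRepTorsion W p)) ∣ p - 1 ∧
        ¬ ∃ L : AddSubgroup (geomTorsion W (p : ℤ)), Nat.card L = p ∧
          ∀ σ ∈ 𝔓.inertia (absoluteGaloisGroup ℚ), ∀ P ∈ L, σ • P ∈ L) :=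
  card_inertia_map_eq_sub_one_or_not_dvd_sub_one hv h𝔓
    (Additive.O8.not_dvd_card_inertia_map_galoisRepTorsion W p hX hns 𝔓)

/-- **O8: stable pair ⟺ `e_p = p − 1`** on every O8 row at every `p`.
[cite: Serre1972, §1.3, §1.11 and §2.4 Prop. 15] -/
theorem O8.stablePair_iff_card_inertia_map_eq_sub_one (hX : ClassX4 W p) (hns : ¬ Surj W p)
    {v : HeightOneSpectrum (𝓞 ℚ)} (hv : ((p : ℕ) : 𝓞 ℚ) ∈ v.asIdeal)
    {𝔓 : Ideal (absIntegers (𝓞 ℚ) ℚ)} (h𝔓 : 𝔓 ∈ v.primesAbove) :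
    (∃ X Y : AddSubgroup (geomTorsion W (p : ℤ)), Nat.card X = p ∧ Nat.card Y = p ∧
        X ⊓ Y = ⊥ ∧ X ⊔ Y = ⊤ ∧
        (∀ σ ∈ 𝔓.inertia (absoluteGaloisGroup ℚ), ∀ P ∈ X, σ • P ∈ X) ∧
        (∀ σ ∈ 𝔓.inertia (absoluteGaloisGroup ℚ), ∀ P ∈ Y, σ • P ∈ Y)) ↔
      Nat.card ((𝔓.inertia (absoluteGaloisGroup ℚ)).map (galoisRepTorsion W p)) = p - 1 :=
  exists_stablePair_iff_card_inertia_map_eq_sub_one hv h𝔓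
    (Additive.O8.not_dvd_card_inertia_map_galoisRepTorsion W p hX hns 𝔓)

end Dichotomy

end Summit.BirchSwinnertonDyer.Rank1Residual.GaloisImage

end
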